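import Literature.Geometry.Riemannian.WeightedHeatFlowFromLinearHeat
import HarnessLib

/-!
# EE(K,4) for smooth positive densities from the static linear heat problem and the
# entropy–energy inequality along the heat flow
(stub `stub_entropyEnergy_positive`, B3a, of line `curvature-dimension-entropy-floor`, crux
`EntropyRung.SubcylindricalExistence`, item stmt-SmoothPoincare4-10871)

On a closed connected Riemannian `4`-manifold `(M, g)` (Levi-Civita connection) with `Ric ≥ K g`,
`K > 0`, we prove the implication

  (B2) entropy–energy inequality ALONG the unweighted heat flow
    (`H(0) ≤ 2 log(1 + I(0)/(4K))` for unit-mass solutions of `∂ₜf = Δf − |∇f|²` with `H → 0`)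
  → (A) solvability of the static linear heat-type Cauchy problem `∂ₛw = Δ_g w − Q w` on `M × [0, T]`
  → (B3a) for every smooth `φ` with `∫ e^φ dV = Vol`:
    `(1/Vol) ∫ φ e^φ dV ≤ 2 log(1 + ∫ |∇φ|² e^φ dV / (4K·Vol))`.

This is exactly the pattern of `Literature.Geometry.Riemannian.logSobolev_of_heatExistence` ∘
`logSobolev_of_heatFlow` with (B2) in place of `entropy_le_fisher_div`, for the CONSTANT weight
`V ≡ c := log Vol` (`e^{-c} dV = dV/Vol` has unit mass, `Hess V = 0`):

* the flow `u` on `M × [0, ∞)` from `u(0) = e^φ` is `heatDrift_global_of_finite` ∘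
  `heatDrift_finite_of_staticLinearHeat` fed by (A);
* positivity by the minimum principle `heatFlow_ge_of_ge`, conservation of mass
  `heatFlow_integral_eq`, convergence to equilibrium `heatFlow_tendstoUniformly`;
* `f = −log u` solves `∂ₜf = Δf − |∇f|²` (`negLog_heat_equation`, the drift `g⁻¹(dV, df)`
  vanishing since `dV = 0`), and `H(t) → 0` (`tendsto_entropy_of_tendstoUniformly`);
* (B2) at `(c, K)` and the rewriting `f(0) = −φ`, `|∇(−φ)|² = |∇φ|²`, `e^{-c} = 1/Vol`.

Everything is proved; no definition, no named fact.

References: J. A. Carrillo, L. Ni, Comm. Anal. Geom. 17 (2009), §3 [CarrilloNi2009];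
D. Bakry, M. Émery, LNM 1123 (1985) [BakryEmery1985]; D. Bakry, I. Gentil, M. Ledoux,
*Analysis and Geometry of Markov Diffusion Operators* (2014), §6 [BakryGentilLedoux2014].
-/

noncomputable section

-- the registered namespace `Summit.SmoothPoincare4.SmoothPoincare4.Theorems` repeats a component
set_option linter.dupNamespace false

open Bundle Set Function Filter Module MeasureTheory
open scoped Manifold ContDiff Topology ENNReal

namespace Summit.SmoothPoincare4.SmoothPoincare4.Theorems

open Literature.Geometry Literature.Geometry.Lorentzian Literature.Geometry.Riemannian
  Literature.Geometry.Lorentzian.PseudoRiemannianMetric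

section ConstWeight

variable {E : Type*} [NormedAddCommGroup E] [NormedSpace ℝ E]
  {H : Type*} [TopologicalSpace H] {I : ModelWithCorners ℝ E H}
  {M : Type*} [TopologicalSpace M] [ChartedSpace H M] [IsManifold I ∞ M]

/-- The Hessian of a constant weight vanishes (`Hess c (X, Y) = X(Y c) − (∇_X Y) c = 0`), under
the Levi-Civita hypothesis of the Hessian API (re-proof of `PseudoRiemannianMetric.hessian_const`
of `BlackHoles.lean`, not in the import cone here). [folklore] -/
theorem hessian_constWeight_eq_zero
    (g : PseudoRiemannianMetric I ∞ E (TangentSpace I : M → Type _)) [g.HasLeviCivita]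
    (c : ℝ) (x : M) : g.hessian (fun _ ↦ c) x = 0 := by
  have haux : ∀ X Y : Π x : M, TangentSpace I x, g.hessianAux (fun _ ↦ c) X Y x = 0 := by
    intro X Y
    simp [PseudoRiemannianMetric.hessianAux, mvfderiv_const]
  unfold PseudoRiemannianMetric.hessian
  have hex : ∃ B : LinearMap.BilinForm ℝ (TangentSpace I x), ∀ X₀ Y₀ : TangentSpace I x,
      B X₀ Y₀ =
        g.hessianAux (fun _ ↦ c) (FiberBundle.extend E X₀) (FiberBundle.extend E Y₀) x :=
    ⟨0, fun _ _ ↦ by simp [haux]⟩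
  rw [dif_pos hex]
  ext X₀ Y₀
  simpa [haux] using hex.choose_spec X₀ Y₀

/-- The drift term of the weighted Laplacian vanishes for a constant weight:
`g⁻¹(d c, α) = 0`. [folklore] -/
theorem innerDual_mvfderiv_constWeight [FiniteDimensional ℝ E]
    (g : PseudoRiemannianMetric I ∞ E (TangentSpace I : M → Type _))
    (c : ℝ) (x : M) (α : TangentSpace I x →ₗ[ℝ] ℝ) :
    g.innerDual x (mvfderiv I (fun _ : M ↦ c) x : TangentSpace I x →ₗ[ℝ] ℝ) α = 0 := by
  simp [PseudoRiemannianMetric.innerDual, mvfderiv_const]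

end ConstWeight

/-- STUB B3a of line `curvature-dimension-entropy-floor` —
`EntropyEnergyAlongFlow → StaticLinearHeat → EntropyEnergyPositive`: **the curvature–dimension
entropy–energy inequality EE(K,4) for smooth positive densities** `ρ = e^φ`, `∫ e^φ dV = Vol`, on a
closed connected Riemannian `4`-manifold with `Ric ≥ K g`, `K > 0`:
`(1/Vol) ∫ φ e^φ dV ≤ 2 log(1 + ∫ |∇φ|² e^φ dV/(4K·Vol))`, GIVEN (hypothesis 1) the inequality
`H(0) ≤ 2 log(1 + I(0)/(4K))` along unit-mass solutions of `∂ₜf = Δf − |∇f|²` with `H → 0` and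
(hypothesis 2) the solvability of the static linear heat-type problem `∂ₛw = Δ_g w − Q w` smoothly on
`M × [0, T]`. Proof: run the heat flow from `e^φ` with the constant weight `V ≡ log Vol` — the exact
pattern of `logSobolev_of_heatExistence` / `logSobolev_of_heatFlow` (`heatDrift_global_of_finite`,
`heatDrift_finite_of_staticLinearHeat`, `heatFlow_ge_of_ge`, `heatFlow_integral_eq`,
`heatFlow_tendstoUniformly`, `negLog_heat_equation`, `tendsto_entropy_of_tendstoUniformly`) — and
apply hypothesis 1 at `c = log Vol`. [cite: CarrilloNi2009, §3] -/
theorem stub_entropyEnergy_positive :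
    (∀ (M : Type) [TopologicalSpace M] [T2Space M] [SecondCountableTopology M]
      [ChartedSpace (EuclideanSpace ℝ (Fin 4)) M] [IsManifold (𝓡 4) ∞ M] [CompactSpace M] [T3Space M]
      [MeasurableSpace M] [BorelSpace M]
      (g : PseudoRiemannianMetric (𝓡 4) ∞ (EuclideanSpace ℝ (Fin 4)) (TangentSpace (𝓡 4) : M → Type _))
      [g.HasLeviCivita] (_hg : g.IsRiemannian) (c K : ℝ), 0 < K →
      (∀ (y : M) (X : TangentSpace (𝓡 4) y), K * g.val y X X ≤ g.ricci y X X) →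
      ∀ f : ℝ → M → ℝ,
        ContMDiffOn ((𝓡 4).prod 𝓘(ℝ, ℝ)) 𝓘(ℝ, ℝ) ∞ (fun p : M × ℝ ↦ f p.2 p.1) (univ ×ˢ Ici 0) →
        (∀ t ∈ Ici (0 : ℝ), ∀ y : M, derivWithin (fun s ↦ f s y) (Ici 0) t =
          g.dalembertian (f t) y - g.gradSq (f t) y) →
        (∀ t ∈ Ici (0 : ℝ), ∫ y, Real.exp (-f t y) * Real.exp (-c) ∂g.riemVolume = 1) →
        Filter.Tendsto (fun s ↦ ∫ y, (-f s y) * Real.exp (-f s y) * Real.exp (-c) ∂g.riemVolume)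
          Filter.atTop (𝓝 0) →
        ∫ y, (-f 0 y) * Real.exp (-f 0 y) * Real.exp (-c) ∂g.riemVolume ≤
          2 * Real.log (1 + (1 / (4 * K)) *
            ∫ y, g.gradSq (f 0) y * Real.exp (-f 0 y) * Real.exp (-c) ∂g.riemVolume)) →
    (∀ (M : Type) [TopologicalSpace M] [T2Space M] [SecondCountableTopology M]
      [ChartedSpace (EuclideanSpace ℝ (Fin 4)) M] [IsManifold (𝓡 4) ∞ M] [CompactSpace M] [T3Space M]
      [MeasurableSpace M] [BorelSpace M] [ConnectedSpace M]
      (g : PseudoRiemannianMetric (𝓡 4) ∞ (EuclideanSpace ℝ (Fin 4)) (TangentSpace (𝓡 4) : M → Type _))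
      [g.HasLeviCivita] (T : ℝ), 0 < T → g.IsRiemannian →
      ∀ Q : M → ℝ, ContMDiff (𝓡 4) 𝓘(ℝ, ℝ) ∞ Q → ∀ w₀ : M → ℝ, ContMDiff (𝓡 4) 𝓘(ℝ, ℝ) ∞ w₀ →
        ∃ w : ℝ → M → ℝ,
          ContMDiffOn ((𝓡 4).prod 𝓘(ℝ, ℝ)) 𝓘(ℝ, ℝ) ∞ (fun p : M × ℝ ↦ w p.2 p.1) (univ ×ˢ Icc 0 T) ∧
          w 0 = w₀ ∧
          ∀ s ∈ Icc 0 T, ∀ x : M, HasDerivWithinAt (fun r ↦ w r x)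
            (g.dalembertian (w s) x - Q x * w s x) (Icc 0 T) s) →
    ∀ (M : Type) [TopologicalSpace M] [T2Space M] [SecondCountableTopology M]
      [ChartedSpace (EuclideanSpace ℝ (Fin 4)) M] [IsManifold (𝓡 4) ∞ M] [CompactSpace M] [T3Space M]
      [MeasurableSpace M] [BorelSpace M] [ConnectedSpace M]
      (g : PseudoRiemannianMetric (𝓡 4) ∞ (EuclideanSpace ℝ (Fin 4)) (TangentSpace (𝓡 4) : M → Type _))
      [g.HasLeviCivita] (_hg : g.IsRiemannian) (K : ℝ), 0 < K →
      (∀ (y : M) (X : TangentSpace (𝓡 4) y), K * g.val y X X ≤ g.ricci y X X) →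
      ∀ φ : M → ℝ, ContMDiff (𝓡 4) 𝓘(ℝ, ℝ) ∞ φ →
        ∫ x, Real.exp (φ x) ∂g.riemVolume = (g.riemVolume Set.univ).toReal →
        (∫ x, φ x * Real.exp (φ x) ∂g.riemVolume) / (g.riemVolume Set.univ).toReal ≤
          2 * Real.log (1 + (∫ x, g.gradSq φ x * Real.exp (φ x) ∂g.riemVolume)
            / (4 * K * (g.riemVolume Set.univ).toReal)) := by
  intro hB2 hA M _ _ _ _ _ _ _ _ _ _ g _ hg K hK hRic φ hφ hφmass
  haveI : Nonempty M := ConnectedSpace.toNonempty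
  have hS : UniqueDiffOn ℝ (Ici (0 : ℝ)) := uniqueDiffOn_Ici 0
  -- the volume and the constant weight `V ≡ c = log Vol`
  set Vvol : ℝ := (g.riemVolume Set.univ).toReal with hVvol
  have hVpos : 0 < Vvol :=
    ENNReal.toReal_pos (riemVolume_univ_pos hg).ne' (riemVolume_univ_lt_top g).ne
  set c : ℝ := Real.log Vvol with hcdef
  have hexpc : Real.exp (-c) = Vvol⁻¹ := by rw [hcdef, Real.exp_neg, Real.exp_log hVpos]
  set V : M → ℝ := fun _ ↦ c with hVdef
  have hV : ContMDiff (𝓡 4) 𝓘(ℝ, ℝ) ∞ V := contMDiff_const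
  have hmass : ∫ x, Real.exp (-V x) ∂g.riemVolume = 1 := by
    simp only [hVdef, integral_const, smul_eq_mul, Measure.real, hexpc]
    exact mul_inv_cancel₀ hVpos.ne'
  have hRic' : ∀ (y : M) (X : TangentSpace (𝓡 4) y),
      K * g.val y X X ≤ g.ricci y X X + g.hessian V y X X := by
    intro y X
    rw [hVdef, hessian_constWeight_eq_zero g c y, LinearMap.zero_apply, LinearMap.zero_apply,
      add_zero]
    exact hRic y X
  -- (1) the flow from `e^φ`, smooth on `M × [0, ∞)`
  obtain ⟨u, hu, hu0, hueq⟩ := heatDrift_global_of_finite g hg (V := V)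
    (fun T hT k₀ hk₀ ↦ heatDrift_finite_of_staticLinearHeat g (T := T)
      (fun Q hQ w₀ hw₀ ↦ hA M g T hT hg Q hQ w₀ hw₀) hV k₀ hk₀)
    (fun x ↦ Real.exp (φ x)) (Real.contDiff_exp.comp_contMDiff hφ)
  have hslice : ∀ t ∈ Ici (0 : ℝ), ContMDiff (𝓡 4) 𝓘(ℝ, ℝ) ∞ (u t) := fun t ht ↦
    hu.comp_contMDiff (contMDiff_id.prodMk contMDiff_const) fun y ↦ ⟨mem_univ _, ht⟩
  -- (2) positivity (minimum principle with `a = min e^φ > 0`)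
  obtain ⟨xm, -, hxm⟩ := (isCompact_univ (X := M)).exists_isMinOn univ_nonempty
    (Real.continuous_exp.comp hφ.continuous).continuousOn
  have ha : ∀ x, Real.exp (φ xm) ≤ u 0 x := fun x ↦ by rw [hu0]; exact hxm (mem_univ x)
  have hupos : ∀ t ∈ Ici (0 : ℝ), ∀ x, 0 < u t x := fun t ht x ↦
    lt_of_lt_of_le (Real.exp_pos _) (heatFlow_ge_of_ge g hg hu hueq ha t ht x)
  -- unit mass of the initial datum and convergence to equilibrium `u(t, ·) → 1`
  have hu0mass : ∫ x, u 0 x * Real.exp (-V x) ∂g.riemVolume = 1 := by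
    rw [hu0]
    simp only [hVdef, hexpc]
    rw [integral_mul_const, hφmass]
    exact mul_inv_cancel₀ hVpos.ne'
  have hulim := heatFlow_tendstoUniformly g hg hK hV hRic' hmass hu hueq
  rw [hu0mass] at hulim
  -- (3) `f = −log u` solves `∂ₜf = Δf − |∇f|²`
  set f : ℝ → M → ℝ := fun t y ↦ -Real.log (u t y) with hfdef
  have hf : ContMDiffOn ((𝓡 4).prod 𝓘(ℝ, ℝ)) 𝓘(ℝ, ℝ) ∞ (fun p : M × ℝ ↦ f p.2 p.1)
      (univ ×ˢ Ici 0) := by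
    intro p hp
    have hne : u p.2 p.1 ≠ 0 := (hupos p.2 hp.2 p.1).ne'
    exact ((Real.contDiffAt_log.2 hne).comp_contMDiffWithinAt
      (f := fun p : M × ℝ ↦ u p.2 p.1) (x := p) (hu p hp)).neg
  have heq : ∀ t ∈ Ici (0 : ℝ), ∀ y : M, derivWithin (fun s ↦ f s y) (Ici 0) t =
      g.dalembertian (f t) y - g.gradSq (f t) y := by
    intro t ht y
    have hut : ContMDiffAt (𝓡 4) 𝓘(ℝ, ℝ) 2 (u t) y :=
      ((hslice t ht).of_le (WithTop.coe_le_coe.mpr le_top)).contMDiffAt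
    have h := negLog_heat_equation g hut (hupos t ht y)
      (hasDerivWithinAt_time_of_contMDiffOn (k := ∞) (by simp) hu y ht) (hS t ht) (hueq t ht y)
    rw [h, hVdef, innerDual_mvfderiv_constWeight, sub_zero]
  -- unit mass for all times
  have hmass_t : ∀ t ∈ Ici (0 : ℝ),
      ∫ y, Real.exp (-f t y) * Real.exp (-c) ∂g.riemVolume = 1 := by
    intro t ht
    have h := heatFlow_integral_eq g hg hV hu hueq t ht
    rw [hu0mass] at h
    rw [← h]
    refine integral_congr_ae (Eventually.of_forall fun y ↦ ?_)
    have hp : 0 < u t y := hupos t ht y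
    simp only [hfdef, hVdef, neg_neg, Real.exp_log hp]
  -- (4) `H(t) → 0`
  have hlim : Tendsto
      (fun s ↦ ∫ y, (-f s y) * Real.exp (-f s y) * Real.exp (-c) ∂g.riemVolume)
      atTop (𝓝 0) := by
    have h := tendsto_entropy_of_tendstoUniformly g hV hmass
      (fun t ht ↦ (hslice t ht).continuous) hulim
    refine h.congr' ?_
    filter_upwards [eventually_ge_atTop (0 : ℝ)] with t ht
    refine integral_congr_ae (Eventually.of_forall fun y ↦ ?_)
    have hp : 0 < u t y := hupos t ht y
    simp only [hfdef, hVdef, neg_neg, Real.exp_log hp]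
    ring
  -- (5) hypothesis 1 at `(c, K)`, and the rewriting `f 0 = −φ`, `e^{-c} = 1/Vol`
  have hmain := hB2 M g hg c K hK hRic f hf heq hmass_t hlim
  have hf0 : f 0 = fun y ↦ -φ y := by
    funext y
    simp only [hfdef, hu0, Real.log_exp]
  have hq : ∀ y, g.gradSq (fun y ↦ -φ y) y = g.gradSq φ y := fun y ↦ g.gradSq_neg φ y
  rw [hf0] at hmain
  simp only [neg_neg, hq] at hmain
  rw [integral_mul_const, integral_mul_const, hexpc] at hmain
  have hr : 1 / (4 * K) * ((∫ y, g.gradSq φ y * Real.exp (φ y) ∂g.riemVolume) * Vvol⁻¹) =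
      (∫ y, g.gradSq φ y * Real.exp (φ y) ∂g.riemVolume) / (4 * K * Vvol) := by
    field_simp
  rw [hr, ← div_eq_mul_inv] at hmain
  exact hmain

end Summit.SmoothPoincare4.SmoothPoincare4.Theorems

end
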